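import Mathlib.NumberTheory.LSeries.Deriv
import Literature.NumberTheory.Automorphic.JacquetShalikaSchurSelfSum
import HarnessLib

/-!
# The real-quotient input of Jacquet–Shalika's (5.3.3) is equivalent to the junction (J)

Topic `NumberTheory/Automorphic`; namespace `Literature.NumberTheory.Automorphic`. Proof file
(theorems only: no definition, no named fact, no instance) on top of `JacquetShalikaLargeFinset` and
`JacquetShalikaSchurSelfSum`, towards the discharge of the named fact
`JacquetShalika1981_realQuotient_partialPairL_conj` of `JacquetShalikaLargeFinset` (Jacquet–Shalika,
*On Euler products and the classification of automorphic representations I*, Amer. J. Math. **103**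
(1981), proof of Lemma (5.2), p. 555, specialised to real points: for a cuspidal `Π` of `GL_n(𝔸_K)`,
`S ⊇ S₀` finite and a Satake family `α` of `Π` off `S`, at every real `σ₀ > 1` the partial
Rankin–Selberg Euler product `L_S(s, α × ᾱ)` has a quotient representation `I = A · L_S` on a right
half-plane with `I`, `A` holomorphic on `re s > 1` and `A(σ₀) ≠ 0`).

`JacquetShalikaLargeFinset` proved that this real-quotient statement *implies* the junction
**(J)** = `summable_normSq_trace_largeFinset` (the convergence of the series (5.3.3),
`∑_{v ∉ S} ∑_{k ≥ 1} |tr A_v^k|² / (k q_v^{kσ}) < ∞` for `σ > 1`, off large finite `S`; loc. cit.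
p. 556), by the quotient form of Landau's lemma. This file proves the **converse**, which is
elementary: if (5.3.3) converges for every `σ > 1`, then the Dirichlet series
`D(s) = ∑ c_m m^{-s}` over `ℕ` obtained by regrouping (5.3.3) (`normSqTraceSeries`, non-negative
coefficients) has abscissa of absolute convergence `≤ 1`, so `I(s) = exp D(s)` is holomorphic on
`re s > 1` (Mathlib `LSeries_differentiableOn`), and `I = L_S(s, α × ᾱ)` on the half-plane
`re s > 2(n² + 1) + 1` where the Euler product converges absolutely under the trivial bound
`|α_{v,i}| ≤ q_v^{n² + 1}` (`partialPairL_conjFamily_eq_exp_LSeries_of_rpow`,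
`IsSatakeFamilyOf.norm_le_rpow` of `SatakeParameterTrivialBound`; loc. cit. p. 556, (2)–(4):
"`L_S(s, π × π̄) = exp ∑ …`"). Take `A = 1`.

Consequently the real-quotient fact is **equivalent** to (J)
(`JacquetShalika1981_realQuotient_iff_largeFinset`), hence to the boundedness of the unramified
Rankin–Selberg torus sums (`JacquetShalika1981_realQuotient_iff_schurSelfSum_prod_bounded`, through
the equivalences of `JacquetShalikaSchurSelfSum`), and it follows from the arbitrary-`S` fact
`summable_normSq_trace_satakePow` of `AutomorphicLFunctionProofs`
(`JacquetShalika1981_realQuotient_of_summable_normSq_trace_satakePow`). The discharge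
`JacquetShalika1981_realQuotient_partialPairL_conj_holds` is thereby reduced to *any* proof of
(J) — the common target of the real-point Rankin–Selberg / mean-square programme of the topic
(`WhittakerCoeffCuspidal`, `UnipotentTateDomain`, `WhittakerBesselGL2`, …).

## Main statements

* `differentiableOn_cexp_LSeries_normSqTraceSeries` — if (5.3.3) converges for all `σ > 1` then
  `s ↦ exp (LSeries (normSqTraceSeries S α) s)` is holomorphic on `re s > 1`;
* `cexp_LSeries_normSqTraceSeries_eq_partialPairL_of_rpow` — and equals `L_S(s, α × ᾱ)` for
  `re s > 2B + 1` under `|α_{v,i}| ≤ q_v^B`;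
* `JacquetShalika1981_realQuotient_of_largeFinset`, `JacquetShalika1981_realQuotient_iff_largeFinset`
  — **(J) ⇔ the real-quotient fact**;
* `JacquetShalika1981_realQuotient_of_schurSelfSum_prod_bounded`,
  `JacquetShalika1981_realQuotient_iff_schurSelfSum_prod_bounded`,
  `JacquetShalika1981_realQuotient_of_summable_normSq_trace_satakePow`.

## References

* H. Jacquet, J. A. Shalika, *On Euler products and the classification of automorphic
  representations I*, Amer. J. Math. 103 (1981), 499–558: Lemma (5.2) p. 554 and its proof p. 555;
  proof of Thm. (5.3), (5.3.3)–(5.3.4) and (2)–(4), p. 556 [JacquetShalikaAJM1981].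
* J. W. Cogdell, *Analytic theory of L-functions for GL_n*, in: J. Bernstein, S. Gelbart (eds.),
  *An Introduction to the Langlands Program*, Birkhäuser (2004), §2.3, §4.1 [CogdellAnalyticTheory2004].
-/

noncomputable section

open scoped MatrixGroups ComplexConjugate
open NumberField IsDedekindDomain MeasureTheory Complex Filter

namespace Literature.NumberTheory.Automorphic

/-! ### One family: (5.3.3) for all `σ > 1` makes `exp D(s)` a continuation of `L_S(s, α × ᾱ)` -/

section OneFamily

variable {K : Type} [Field K] [NumberField K]

/-- If the series (5.3.3) of the family `α` off `S` converges for every real `σ > 1`, then the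
regrouped Dirichlet series `normSqTraceSeries S α` over `ℕ` has abscissa of absolute convergence
`≤ 1` (its summability at the real point `σ` *is* the convergence of (5.3.3) at `σ`,
`summable_jsCoeff_mul_rpow_neg_iff`). [folklore] -/
theorem abscissaOfAbsConv_normSqTraceSeries_le_one_of_summable {S : Set (HeightOneSpectrum (𝓞 K))}
    {α : SatakeFamily K}
    (hs : ∀ ⦃σ : ℝ⦄, 1 < σ →
      Summable fun kv : ℕ × {v : HeightOneSpectrum (𝓞 K) // v ∉ S} =>
        ‖((α kv.2.1).map (· ^ (kv.1 + 1))).sum‖ ^ 2 /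
          ((kv.1 + 1 : ℝ) * (kv.2.1.residueCard : ℝ) ^ ((kv.1 + 1 : ℝ) * σ))) :
    LSeries.abscissaOfAbsConv (normSqTraceSeries S α) ≤ (1 : ℝ) := by
  refine LSeries.abscissaOfAbsConv_le_of_forall_lt_LSeriesSummable fun y hy => ?_
  refine (summable_jsCoeff_mul_rpow_neg_iff S α y).mp ?_
  exact (hs (by exact_mod_cast hy)).congr fun i => (jsCoeff_mul_rpow_neg S α y i).symm

/-- **`exp D(s)` is holomorphic on `re s > 1`** when (5.3.3) converges for every `σ > 1`: an
`L`-series is holomorphic on its open half-plane of absolute convergence (Mathlib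
`LSeries_differentiableOn`), which contains `re s > 1` by
`abscissaOfAbsConv_normSqTraceSeries_le_one_of_summable`. [folklore] -/
theorem differentiableOn_cexp_LSeries_normSqTraceSeries {S : Set (HeightOneSpectrum (𝓞 K))}
    {α : SatakeFamily K}
    (hs : ∀ ⦃σ : ℝ⦄, 1 < σ →
      Summable fun kv : ℕ × {v : HeightOneSpectrum (𝓞 K) // v ∉ S} =>
        ‖((α kv.2.1).map (· ^ (kv.1 + 1))).sum‖ ^ 2 /
          ((kv.1 + 1 : ℝ) * (kv.2.1.residueCard : ℝ) ^ ((kv.1 + 1 : ℝ) * σ))) :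
    DifferentiableOn ℂ (fun s => cexp (LSeries (normSqTraceSeries S α) s)) {s : ℂ | 1 < s.re} := by
  have h1 := abscissaOfAbsConv_normSqTraceSeries_le_one_of_summable hs
  refine ((LSeries_differentiableOn (normSqTraceSeries S α)).mono fun s hs1 => ?_).cexp
  exact h1.trans_lt (by exact_mod_cast hs1)

/-- **`exp D(s) = L_S(s, α × ᾱ)` for `re s > 2B + 1`** under a bound `|α_{v,i}| ≤ q_v^B` and
`card (α v) ≤ n` (the Euler product (2) of Jacquet–Shalika (1981), p. 556, converges absolutely
there and is the exponential of (5.3.3): `partialPairL_conjFamily_eq_exp_LSeries_of_rpow` of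
`SatakeParameterTrivialBound`, restated). [cite: JacquetShalikaAJM1981, Thm. (5.3), proof, (2)–(4), p. 556] -/
theorem cexp_LSeries_normSqTraceSeries_eq_partialPairL_of_rpow {S : Set (HeightOneSpectrum (𝓞 K))}
    {α : SatakeFamily K} {n : ℕ} {B : ℝ}
    (hb : ∀ v ∉ S, ∀ a ∈ α v, ‖a‖ ≤ (v.residueCard : ℝ) ^ B)
    (hcard : ∀ v ∉ S, Multiset.card (α v) ≤ n) {s : ℂ} (hs : 2 * B + 1 < s.re) :
    cexp (LSeries (normSqTraceSeries S α) s) = partialPairL S α (conjFamily α) s :=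
  (partialPairL_conjFamily_eq_exp_LSeries_of_rpow hb hcard hs).symm

/-- **The real-quotient representation from (5.3.3), for one family.** If `|α_{v,i}| ≤ q_v^B`,
`card (α v) ≤ n` off `S`, and (5.3.3) converges for every `σ > 1`, then with `x₀ = 2B + 1`, for
every `σ₀` (no restriction is needed) the pair `I = exp D`, `A = 1` is holomorphic on `re s > 1`,
`A σ₀ ≠ 0`, and `I s = A s · L_S(s, α × ᾱ)` for `re s > x₀`. [folklore] -/
theorem exists_realQuotient_of_summable_normSq_trace {S : Set (HeightOneSpectrum (𝓞 K))}
    {α : SatakeFamily K} {n : ℕ} {B : ℝ}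
    (hb : ∀ v ∉ S, ∀ a ∈ α v, ‖a‖ ≤ (v.residueCard : ℝ) ^ B)
    (hcard : ∀ v ∉ S, Multiset.card (α v) ≤ n)
    (hs : ∀ ⦃σ : ℝ⦄, 1 < σ →
      Summable fun kv : ℕ × {v : HeightOneSpectrum (𝓞 K) // v ∉ S} =>
        ‖((α kv.2.1).map (· ^ (kv.1 + 1))).sum‖ ^ 2 /
          ((kv.1 + 1 : ℝ) * (kv.2.1.residueCard : ℝ) ^ ((kv.1 + 1 : ℝ) * σ)))
    (σ₀ : ℝ) :
    ∃ I A : ℂ → ℂ, DifferentiableOn ℂ I {s : ℂ | 1 < s.re} ∧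
      DifferentiableOn ℂ A {s : ℂ | 1 < s.re} ∧ A σ₀ ≠ 0 ∧
        ∀ s : ℂ, 1 < s.re → 2 * B + 1 < s.re → I s = A s * partialPairL S α (conjFamily α) s :=
  ⟨fun s => cexp (LSeries (normSqTraceSeries S α) s), fun _ => 1,
    differentiableOn_cexp_LSeries_normSqTraceSeries hs, differentiableOn_const 1, one_ne_zero,
    fun _ _ hs' => by
      rw [one_mul]
      exact cexp_LSeries_normSqTraceSeries_eq_partialPairL_of_rpow hb hcard hs'⟩

end OneFamily

/-! ### (J) ⇔ the real-quotient fact, and the other feeds -/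

section Cuspidal

variable {n : ℕ} {K : Type} [Field K] [NumberField K]
  {μ : Measure (AdelicGroupData.gl n K).automorphicQuotient}
  [(AdelicGroupData.gl n K).IsAutomorphicMeasure μ]

/-- **(J) implies the real-quotient fact.** For `S ⊇ S₀` and a Satake family `α` of `Π` off `S`,
(J) gives (5.3.3) for every `σ > 1`; the trivial bound `|α_{v,i}| ≤ q_v^{n² + 1}`
(`IsSatakeFamilyOf.norm_le_rpow`) and `card (α v) = n` (`IsSatakeFamilyOf.card_eq`) put us in
`exists_realQuotient_of_summable_normSq_trace` with `x₀ = 2(n² + 1) + 1`: `I = exp D`, `A = 1`.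
This is the trivial direction of the equivalence between the convergence of (5.3.3) and the
holomorphy of `L_S(s, π × π̄) = exp D(s)` at the real points of `re s > 1` (Jacquet–Shalika (1981),
p. 556). [cite: JacquetShalikaAJM1981, Thm. (5.3), proof, (5.3.3)–(5.3.4), p. 556] -/
theorem JacquetShalika1981_realQuotient_of_largeFinset
    (h : summable_normSq_trace_largeFinset (μ := μ)) :
    JacquetShalika1981_realQuotient_partialPairL_conj (μ := μ) := by
  intro P
  obtain ⟨S₀, hS₀⟩ := h P
  refine ⟨S₀, fun S α hS hα => ⟨2 * ((n : ℝ) ^ 2 + 1) + 1, fun σ₀ _ => ?_⟩⟩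
  exact exists_realQuotient_of_summable_normSq_trace (n := n) (B := (n : ℝ) ^ 2 + 1)
    (fun v hv a ha => hα.norm_le_rpow hv ha) (fun v hv => (hα.card_eq hv).le)
    (fun σ hσ => hS₀ hS hα hσ) σ₀

/-- **The real-quotient fact is equivalent to (J)** (`summable_normSq_trace_largeFinset_of_realQuotient`
of `JacquetShalikaLargeFinset` and `JacquetShalika1981_realQuotient_of_largeFinset`). [folklore] -/
theorem JacquetShalika1981_realQuotient_iff_largeFinset :
    JacquetShalika1981_realQuotient_partialPairL_conj (μ := μ) ↔
      summable_normSq_trace_largeFinset (μ := μ) :=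
  ⟨summable_normSq_trace_largeFinset_of_realQuotient, JacquetShalika1981_realQuotient_of_largeFinset⟩

/-- **The real-quotient fact from the boundedness of the unramified Rankin–Selberg torus sums**
(`JacquetShalika1981_schurSelfSum_prod_bounded` of `JacquetShalikaSchurSelfSum`, through (J)).
[folklore] -/
theorem JacquetShalika1981_realQuotient_of_schurSelfSum_prod_bounded
    (h : JacquetShalika1981_schurSelfSum_prod_bounded (μ := μ)) :
    JacquetShalika1981_realQuotient_partialPairL_conj (μ := μ) :=
  JacquetShalika1981_realQuotient_of_largeFinset
    (summable_normSq_trace_largeFinset_of_schurSelfSum_prod_bounded h)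

/-- The real-quotient fact is equivalent to the boundedness of the unramified torus sums (both are
equivalent to (J)). [folklore] -/
theorem JacquetShalika1981_realQuotient_iff_schurSelfSum_prod_bounded :
    JacquetShalika1981_realQuotient_partialPairL_conj (μ := μ) ↔
      JacquetShalika1981_schurSelfSum_prod_bounded (μ := μ) :=
  ⟨fun h => JacquetShalika1981_schurSelfSum_prod_bounded_of_largeFinset
      (summable_normSq_trace_largeFinset_of_realQuotient h),
    JacquetShalika1981_realQuotient_of_schurSelfSum_prod_bounded⟩

/-- **The real-quotient fact from the arbitrary-`S` version of (5.3.3)**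
(`summable_normSq_trace_satakePow` of `AutomorphicLFunctionProofs`, through (J) with `S₀ = ∅`).
[folklore] -/
theorem JacquetShalika1981_realQuotient_of_summable_normSq_trace_satakePow
    (h : summable_normSq_trace_satakePow (μ := μ)) :
    JacquetShalika1981_realQuotient_partialPairL_conj (μ := μ) :=
  JacquetShalika1981_realQuotient_of_largeFinset (summable_normSq_trace_largeFinset_of_summable h)

end Cuspidal

end Literature.NumberTheory.Automorphic
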